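import Mathlib.Topology.Algebra.ClopenNhdofOne
import Mathlib.Topology.Algebra.OpenSubgroup
import Mathlib.Algebra.Module.ZMod
import Mathlib.Algebra.Field.ZMod
import Mathlib.LinearAlgebra.Dual.Lemmas
import Mathlib.LinearAlgebra.FreeModule.Basic
import Mathlib.LinearAlgebra.Basis.VectorSpace
import Mathlib.GroupTheory.QuotientGroup.Basic
import Mathlib.Algebra.Group.TypeTags.Hom
import HarnessLib

/-!
# Characters of order two detecting non-squares, in abelian and in profinite abelian groups

Topic `Literature/Topology/Algebra`.  Theorem-only file (no named fact, no new notion).  The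
elementary substitute for the piece of Pontryagin duality "the continuous characters of order
`≤ 2` of a profinite abelian group `C` separate the points of `C / C²`":

* `exists_monoidHom_apply_eq_ofAdd_one_of_not_isSquare` — **in any abelian group `G`, an
  element `x` which is not a square is sent to the non-trivial element by some homomorphism
  `G → ℤ/2`** (multiplicatively: `G →* Multiplicative (ZMod 2)`): `G / G²` is a vector space over
  `𝔽₂` (`QuotientAddGroup.zmodModule`) in which `x̄ ≠ 0`, and a linear functional with `f(x̄) = 1`
  exists (`Module.Projective.exists_dual_eq_one`).
* `exists_monoidHom_isOpen_ker_apply_eq_ofAdd_one_of_not_isSquare` — **for `C` a profinite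
  (compact, totally disconnected) abelian topological group, the homomorphism can be taken with
  OPEN KERNEL** (i.e. continuous for the discrete topology on `ℤ/2`): `C²` is closed (a compact
  image), so some open subgroup `N` has `xN ∩ C² = ∅` (open subgroups form a basis of
  neighbourhoods of `1`, `ProfiniteGrp.exist_openNormalSubgroup_sub_open_nhds_of_one`), and the
  algebraic statement applies in the quotient `C / N`.

Used for square roots of `p`-adic characters of Galois groups (the `2`-primary obstruction): a
character of a profinite abelian group which is NOT a square is detected on an element whose
square class is non-trivial.

## References

* L. Ribes, P. Zalesskii, *Profinite Groups*, 2nd ed. (2010), §2.9 (Pontryagin duality for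
  profinite abelian groups), Lemma 2.1.2 (open subgroups form a basis at `1`). [RibesZalesskii2010]
-/

namespace Literature.Topology.Algebra

/-! ### Abelian groups: `x ∉ G²` is detected by a character of order two -/

/-- **A non-square is detected by a homomorphism to `ℤ/2`.**  In an abelian group `G`, if `x` is
not a square then some homomorphism `χ : G →* Multiplicative (ZMod 2)` has `χ x = ofAdd 1` (the
non-trivial element): `G/G²` is an `𝔽₂`-vector space in which the class of `x` is non-zero, so a
linear functional takes the value `1` on it. [folklore] -/
theorem exists_monoidHom_apply_eq_ofAdd_one_of_not_isSquare {G : Type*} [CommGroup G] {x : G}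
    (hx : ¬ IsSquare x) :
    ∃ χ : G →* Multiplicative (ZMod 2), χ x = Multiplicative.ofAdd 1 := by
  classical
  -- the subgroup of squares and the quotient
  set S : Subgroup G := (powMonoidHom 2 : G →* G).range with hS
  have hxS : x ∉ S := by
    rintro ⟨c, hc⟩
    exact hx ⟨c, by rw [← hc, powMonoidHom_apply, sq]⟩
  set Q := G ⧸ S with hQ
  have h2 : ∀ q : Additive Q, 2 • q = 0 := by
    intro q
    obtain ⟨g, rfl⟩ : ∃ g : G, Additive.ofMul (QuotientGroup.mk g : Q) = q :=
      ⟨(Additive.toMul q).out, by rw [QuotientGroup.out_eq']; rfl⟩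
    rw [← ofMul_pow, ← QuotientGroup.mk_pow]
    have : (QuotientGroup.mk (g ^ 2) : Q) = 1 :=
      (QuotientGroup.eq_one_iff _).2 ⟨g, rfl⟩
    rw [this]
    rfl
  haveI : Fact (Nat.Prime 2) := ⟨Nat.prime_two⟩
  letI : Module (ZMod 2) (Additive Q) := AddCommGroup.zmodModule h2
  -- the class of `x` is non-zero
  have hx0 : Additive.ofMul (QuotientGroup.mk x : Q) ≠ 0 := by
    intro h0
    apply hxS
    have h1 : (QuotientGroup.mk x : Q) = 1 := by
      have := congrArg Additive.toMul h0
      simpa using this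
    exact (QuotientGroup.eq_one_iff x).1 h1
  obtain ⟨f, hf⟩ := Module.Projective.exists_dual_eq_one (ZMod 2) hx0
  refine ⟨(AddMonoidHom.toMultiplicativeRight f.toAddMonoidHom).comp (QuotientGroup.mk' S), ?_⟩
  rw [MonoidHom.comp_apply, QuotientGroup.mk'_apply]
  change Multiplicative.ofAdd (f (Additive.ofMul (QuotientGroup.mk x : Q))) = _
  rw [hf]

/-! ### Profinite abelian groups: the character can be taken with open kernel -/

/-- **Characters of order two with open kernel detect non-squares in a profinite abelian group.**
Let `C` be an abelian topological group which is compact and totally disconnected (e.g. the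
abelianised absolute Galois group of a field), and `x ∈ C` not a square.  Then there is a
homomorphism `χ : C →* Multiplicative (ZMod 2)` with OPEN kernel (so continuous for the discrete
topology) and `χ x = ofAdd 1`.  Proof: the set of squares `C²` is compact, hence closed, and
`x ∉ C²`, so `{g | x g ∉ C²}` is an open neighbourhood of `1` and contains an open subgroup `N`
(`ProfiniteGrp.exist_openNormalSubgroup_sub_open_nhds_of_one`); then the class of `x` is not a
square in `C / N`, and `exists_monoidHom_apply_eq_ofAdd_one_of_not_isSquare` applies there.
[cite: RibesZalesskii2010, §2.9 and Lemma 2.1.2] -/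
theorem exists_monoidHom_isOpen_ker_apply_eq_ofAdd_one_of_not_isSquare {C : Type*} [CommGroup C]
    [TopologicalSpace C] [IsTopologicalGroup C] [CompactSpace C] [T2Space C]
    [TotallyDisconnectedSpace C] {x : C} (hx : ¬ IsSquare x) :
    ∃ χ : C →* Multiplicative (ZMod 2), IsOpen (χ.ker : Set C) ∧ χ x = Multiplicative.ofAdd 1 := by
  classical
  -- the squares form a closed set not containing `x`
  set F : Set C := Set.range fun c : C => c ^ 2 with hF
  have hFc : IsClosed F := (isCompact_range (continuous_pow 2)).isClosed
  have hxF : x ∉ F := by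
    rintro ⟨c, hc⟩
    exact hx ⟨c, by rw [← hc]; exact sq c⟩
  -- an open subgroup `N` with `x N ∩ F = ∅`
  set U : Set C := (fun g => x * g) ⁻¹' Fᶜ with hU
  have hUo : IsOpen U := hFc.isOpen_compl.preimage (continuous_const.mul continuous_id)
  have h1U : (1 : C) ∈ U := by
    change x * 1 ∈ Fᶜ
    rw [mul_one]
    exact hxF
  obtain ⟨N, hN⟩ := ProfiniteGrp.exist_openNormalSubgroup_sub_open_nhds_of_one hUo h1U
  -- in `C / N` the class of `x` is not a square
  have hxN : ¬ IsSquare (QuotientGroup.mk x : C ⧸ N.toSubgroup) := by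
    rintro ⟨q, hq⟩
    obtain ⟨c, rfl⟩ := QuotientGroup.mk_surjective q
    rw [← QuotientGroup.mk_mul, QuotientGroup.eq] at hq
    have hmem : x⁻¹ * (c * c) ∈ U := hN hq
    change x * (x⁻¹ * (c * c)) ∈ Fᶜ at hmem
    rw [mul_inv_cancel_left] at hmem
    exact hmem ⟨c, sq c⟩
  obtain ⟨χ₀, hχ₀⟩ := exists_monoidHom_apply_eq_ofAdd_one_of_not_isSquare hxN
  refine ⟨χ₀.comp (QuotientGroup.mk' N.toSubgroup), ?_, ?_⟩
  · -- the kernel contains the open subgroup `N`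
    refine Subgroup.isOpen_mono ?_ N.isOpen
    intro n hn
    rw [MonoidHom.mem_ker, MonoidHom.comp_apply, QuotientGroup.mk'_apply,
      (QuotientGroup.eq_one_iff n).2 hn, map_one]
  · rw [MonoidHom.comp_apply, QuotientGroup.mk'_apply]
    exact hχ₀

end Literature.Topology.Algebra
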